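import Summits.CriticalPhenomena.PercolationContinuityZ3.Theorems.PercNonProliferationNonProliferationStubTypeTable
import Summits.CriticalPhenomena.PercolationContinuityZ3.Theorems.PercNonProliferationNonProliferationStubSignedRusso
import Summits.CriticalPhenomena.PercolationContinuityZ3.Theorems.PercNonProliferationNonProliferationStubScreening
import Summits.CriticalPhenomena.PercolationContinuityZ3.Theorems.PercNonProliferationNonProliferationStubAnchor
import Summits.CriticalPhenomena.PercolationContinuityZ3.Theorems.PercNonProliferationNonProliferationStubLedger
import Summits.CriticalPhenomena.PercolationContinuityZ3.Theorems.PercNonProliferationNonProliferationStubLogLedger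
import Summits.CriticalPhenomena.PercolationContinuityZ3.Theorems.NonProliferation.Negative.MZeroSlice
import HarnessLib

/-!
# Crux `PercNonProliferation.NonProliferation` (stmt-CriticalPhenomena-4444), line `birth-merge-ledger` —
# the open stub in its simplest form, and the route-level payoff of the log-ledger (lead's file)

Two consequences of the landed ledger package (`ledger`, `logLedger`,
`stub_anchor`), recorded for the planners:

* `windowBirths_iff_birthBudget` (registered extra stub): the line's one open stub
  `stub_windowBirths` — `∃ C, ∃ᶠ n, ∃ s ∈ [0, p_c]` with `u_n(s) ≤ 1/2` and `∫_s^{p_c} births ≤ C` — is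
  EQUIVALENT to the plain BIRTH BUDGET `∃ C, ∃ᶠ n, ∫_0^{p_c} births ≤ C`: the parameter `s` and the
  threshold `1/2` are inessential (`s = 0` is admissible since `u_n(0) = 0`; conversely the births
  before `s` number at most `E_s N + ∫_0^s merges ≤ -log(1 - u_n(s)) ≤ 1`). A planner promoting the
  stub should promote the birth budget.
* `sum_real_repEvent_le_mul_log_of_subpolynomialBlocking`: the route's rank-4 crux
  `SubpolynomialBlocking` (stmt-CriticalPhenomena-4446: `P_{p_c}(B(n) ↮ ∂ⁱⁿB(2n)) ≥ n^{-s}`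
  eventually, every `s > 0`) forces `E_{p_c}[N_n] ≤ s · log n` eventually, for every `s > 0` — the
  mean number of annulus-spanning box-clusters is then `o(log n)` (from `E_p N_n ≤ -log P_p(blocked)`,
  `BirthBudget.sum_real_repEvent_le_neg_log`).
-/

noncomputable section

namespace Summit.CriticalPhenomena.PercolationContinuityZ3.Theorems.NonProliferation

open MeasureTheory Filter Topology
open Literature.Probability.LatticeModels Literature.Probability.Percolation
open Literature.Barriers.CriticalPhenomena
open Summit.CriticalPhenomena.PercolationContinuityZ3.Theorems.NonProliferation.Negative

namespace BirthBudget

/-- The birth rate `t ↦ Σ_{e ∈ E(B(2n))} P_t(birth_e)` is continuous on `ℝ` (each birth event is a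
cylinder event of the finite box). -/
theorem continuous_birthRate (d n : ℕ) :
    Continuous fun t : ℝ => ∑ e ∈ edgesIn (zdGraph d) (box d (2 * n)), (bondPercolation (zdGraph d) (Set.projIcc (0 : ℝ)
      1 zero_le_one t)).real {ω : BondConfig (Site d) | ∃ x y : Site d, e = s(x, y) ∧ (∃ v ∈ box d
      n, ω \ {e} ∈ openConnIn (↑(box d (2 * n)) : Set (Site d)) x v) ∧ (∀ w ∈ innerBoundary
      (zdGraph d) (box d (2 * n)), ω \ {e} ∉ openConnIn (↑(box d (2 * n)) : Set (Site d)) x w) ∧ (∃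
      w ∈ innerBoundary (zdGraph d) (box d (2 * n)), ω \ {e} ∈ openConnIn (↑(box d (2 * n)) : Set
      (Site d)) y w) ∧ (∀ v ∈ box d n, ω \ {e} ∉ openConnIn (↑(box d (2 * n)) : Set (Site d)) y v)} := by
  refine continuous_finsetSum _ fun e _ => StubLedger.continuous_real_of_determinedBy
    (K := (box d (2 * n)).sym2) ?_
  refine (determinedBy_iff _ _).2 fun ω ω' h => ?_
  have key := StubLedger.sdiff_mem_openConnIn_congr (box d (2 * n)) h e
  simp only [Set.mem_setOf_eq, key]

/-- **Births before `s` are cheap**: for `n ≥ 1`, `0 ≤ s ≤ 1` with `u_n(s) ≤ 1/2`,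
`∫_0^s births ≤ 1` (ledger on `[0,s]`, anchor `E_0 N = 0`, log-ledger, `-log(1/2) ≤ 1`). -/
theorem integral_birthRate_le_one {d n : ℕ} (hn : 1 ≤ n) {s : ℝ} (hs0 : 0 ≤ s) (hs1 : s ≤ 1)
    (hus : (bondPercolation (zdGraph d) (Set.projIcc (0 : ℝ) 1 zero_le_one s)).real (annulusCrossing d
      n) ≤ 1 / 2) :
    ∫ t in (0 : ℝ)..s,         ∑ e ∈ edgesIn (zdGraph d) (box d (2 * n)), (bondPercolation (zdGraph d) (Set.projIcc (0 :
        ℝ) 1 zero_le_one t)).real {ω : BondConfig (Site d) | ∃ x y : Site d, e = s(x, y) ∧ (∃ v ∈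
        box d n, ω \ {e} ∈ openConnIn (↑(box d (2 * n)) : Set (Site d)) x v) ∧ (∀ w ∈ innerBoundary
        (zdGraph d) (box d (2 * n)), ω \ {e} ∉ openConnIn (↑(box d (2 * n)) : Set (Site d)) x w) ∧
        (∃ w ∈ innerBoundary (zdGraph d) (box d (2 * n)), ω \ {e} ∈ openConnIn (↑(box d (2 * n)) :
        Set (Site d)) y w) ∧ (∀ v ∈ box d n, ω \ {e} ∉ openConnIn (↑(box d (2 * n)) : Set (Site d))
        y v)} ≤ 1 := by
  have hL := stub_ledger stub_signedRusso stub_typeTable d n 0 s le_rfl hs0 hs1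
  have hlt : (bondPercolation (zdGraph d) (Set.projIcc (0 : ℝ) 1 zero_le_one s)).real (annulusCrossing d
        n) < 1 := by
    linarith
  have hS := stub_logLedger (stub_ledger stub_signedRusso stub_typeTable) stub_screening stub_anchor d n s
    hn hs0 hs1 hlt
  have hA := (stub_anchor d n hn).1
  have h0 : ∑ k ∈ Finset.range (box d n).card, (bondPercolation (zdGraph d) (Set.projIcc (0 : ℝ) 1
        zero_le_one (0 : ℝ))).real (repEvent d k n) = 0 :=
    Finset.sum_eq_zero fun k _ => hA k
  -- `-log(1 - u) ≤ 1` for `u ≤ 1/2`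
  have hlog1 : ∀ {u : ℝ}, u ≤ 1 / 2 → - Real.log (1 - u) ≤ 1 := by
    intro u hu
    have h1 : (0 : ℝ) < 1 - u := by linarith
    have h2 : (1 - u)⁻¹ ≤ 2 := by
      rw [inv_le_comm₀ h1 (by norm_num : (0 : ℝ) < 2)]
      linarith
    rw [← Real.log_inv]
    calc Real.log (1 - u)⁻¹ ≤ Real.log 2 := Real.log_le_log (inv_pos.2 h1) h2
      _ ≤ 2 - 1 := Real.log_le_sub_one_of_pos (by norm_num)
      _ = 1 := by norm_num
  have hlog2 := hlog1 hus
  linarith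

/-- **Window budget ⟹ birth budget** (general `d`; restrict to `n ≥ 1` inside `∃ᶠ`). -/
theorem birthBudget_of_window {d : ℕ}
    (hW : ∃ C : ℝ, ∃ᶠ n : ℕ in atTop, ∃ s : ℝ, 0 ≤ s ∧ s ≤ (criticalProbI d : ℝ) ∧ (bondPercolation
      (zdGraph d) (Set.projIcc (0 : ℝ) 1 zero_le_one s)).real (annulusCrossing d n) ≤ 1 / 2 ∧ ∫ t
      in s..(criticalProbI d : ℝ), ∑ e ∈ edgesIn (zdGraph d) (box d (2 * n)), (bondPercolation
      (zdGraph d) (Set.projIcc (0 : ℝ) 1 zero_le_one t)).real {ω : BondConfig (Site d) | ∃ x y :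
      Site d, e = s(x, y) ∧ (∃ v ∈ box d n, ω \ {e} ∈ openConnIn (↑(box d (2 * n)) : Set (Site d))
      x v) ∧ (∀ w ∈ innerBoundary (zdGraph d) (box d (2 * n)), ω \ {e} ∉ openConnIn (↑(box d (2 *
      n)) : Set (Site d)) x w) ∧ (∃ w ∈ innerBoundary (zdGraph d) (box d (2 * n)), ω \ {e} ∈
      openConnIn (↑(box d (2 * n)) : Set (Site d)) y w) ∧ (∀ v ∈ box d n, ω \ {e} ∉ openConnIn
      (↑(box d (2 * n)) : Set (Site d)) y v)} ≤ C) :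
    ∃ C : ℝ, ∃ᶠ n : ℕ in atTop, ∫ t in (0 : ℝ)..(criticalProbI d : ℝ), ∑ e ∈ edgesIn (zdGraph d)
      (box d (2 * n)), (bondPercolation (zdGraph d) (Set.projIcc (0 : ℝ) 1 zero_le_one t)).real {ω
      : BondConfig (Site d) | ∃ x y : Site d, e = s(x, y) ∧ (∃ v ∈ box d n, ω \ {e} ∈ openConnIn
      (↑(box d (2 * n)) : Set (Site d)) x v) ∧ (∀ w ∈ innerBoundary (zdGraph d) (box d (2 * n)), ω
      \ {e} ∉ openConnIn (↑(box d (2 * n)) : Set (Site d)) x w) ∧ (∃ w ∈ innerBoundary (zdGraph d)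
      (box d (2 * n)), ω \ {e} ∈ openConnIn (↑(box d (2 * n)) : Set (Site d)) y w) ∧ (∀ v ∈ box d
      n, ω \ {e} ∉ openConnIn (↑(box d (2 * n)) : Set (Site d)) y v)} ≤ C := by
  obtain ⟨C, hC⟩ := hW
  have hpc1 : (criticalProbI d : ℝ) ≤ 1 := (criticalProbI d).2.2
  refine ⟨C + 1, (hC.and_eventually (eventually_ge_atTop 1)).mono ?_⟩
  rintro n ⟨⟨s, hs0, hspc, hus, hwin⟩, hn⟩
  have h1 := integral_birthRate_le_one hn hs0 (hspc.trans hpc1) hus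
  have hcont := continuous_birthRate d n
  rw [← intervalIntegral.integral_add_adjacent_intervals (hcont.intervalIntegrable 0 s)
    (hcont.intervalIntegrable s _)]
  linarith

/-- **Birth budget ⟹ window budget** (general `d`): take `s = 0`, where `u_n(0) = 0 ≤ 1/2`
(`stub_anchor`, `n ≥ 1`). -/
theorem window_of_birthBudget {d : ℕ}
    (hB : ∃ C : ℝ, ∃ᶠ n : ℕ in atTop, ∫ t in (0 : ℝ)..(criticalProbI d : ℝ), ∑ e ∈ edgesIn (zdGraph d)
      (box d (2 * n)), (bondPercolation (zdGraph d) (Set.projIcc (0 : ℝ) 1 zero_le_one t)).real {ω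
      : BondConfig (Site d) | ∃ x y : Site d, e = s(x, y) ∧ (∃ v ∈ box d n, ω \ {e} ∈ openConnIn
      (↑(box d (2 * n)) : Set (Site d)) x v) ∧ (∀ w ∈ innerBoundary (zdGraph d) (box d (2 * n)), ω
      \ {e} ∉ openConnIn (↑(box d (2 * n)) : Set (Site d)) x w) ∧ (∃ w ∈ innerBoundary (zdGraph d)
      (box d (2 * n)), ω \ {e} ∈ openConnIn (↑(box d (2 * n)) : Set (Site d)) y w) ∧ (∀ v ∈ box d
      n, ω \ {e} ∉ openConnIn (↑(box d (2 * n)) : Set (Site d)) y v)} ≤ C) :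
    ∃ C : ℝ, ∃ᶠ n : ℕ in atTop, ∃ s : ℝ, 0 ≤ s ∧ s ≤ (criticalProbI d : ℝ) ∧ (bondPercolation
      (zdGraph d) (Set.projIcc (0 : ℝ) 1 zero_le_one s)).real (annulusCrossing d n) ≤ 1 / 2 ∧ ∫ t
      in s..(criticalProbI d : ℝ), ∑ e ∈ edgesIn (zdGraph d) (box d (2 * n)), (bondPercolation
      (zdGraph d) (Set.projIcc (0 : ℝ) 1 zero_le_one t)).real {ω : BondConfig (Site d) | ∃ x y :
      Site d, e = s(x, y) ∧ (∃ v ∈ box d n, ω \ {e} ∈ openConnIn (↑(box d (2 * n)) : Set (Site d))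
      x v) ∧ (∀ w ∈ innerBoundary (zdGraph d) (box d (2 * n)), ω \ {e} ∉ openConnIn (↑(box d (2 *
      n)) : Set (Site d)) x w) ∧ (∃ w ∈ innerBoundary (zdGraph d) (box d (2 * n)), ω \ {e} ∈
      openConnIn (↑(box d (2 * n)) : Set (Site d)) y w) ∧ (∀ v ∈ box d n, ω \ {e} ∉ openConnIn
      (↑(box d (2 * n)) : Set (Site d)) y v)} ≤ C := by
  obtain ⟨C, hC⟩ := hB
  refine ⟨C, (hC.and_eventually (eventually_ge_atTop 1)).mono ?_⟩
  rintro n ⟨hint, hn⟩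
  refine ⟨0, le_rfl, (criticalProbI d).2.1, ?_, hint⟩
  have h0 := (stub_anchor d n hn).2
  rw [h0]
  norm_num

end BirthBudget

/-- **The open stub in its simplest form** (registered extra stub of stmt-CriticalPhenomena-4444):
`stub_windowBirths` (left) is equivalent to the plain BIRTH BUDGET at `p_c(ℤ³)` (right),
`∃ C, ∃ᶠ n, ∫_0^{p_c} Σ_{e ∈ E(B(2n))} P_t(birth_e) dt ≤ C`. -/
theorem windowBirths_iff_birthBudget :
    (∃ C : ℝ, ∃ᶠ n : ℕ in atTop, ∃ s : ℝ, 0 ≤ s ∧ s ≤ (criticalProbI 3 : ℝ) ∧ (bondPercolation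
      (zdGraph 3) (Set.projIcc (0 : ℝ) 1 zero_le_one s)).real (annulusCrossing 3 n) ≤ 1 / 2 ∧ ∫ t
      in s..(criticalProbI 3 : ℝ), ∑ e ∈ edgesIn (zdGraph 3) (box 3 (2 * n)), (bondPercolation
      (zdGraph 3) (Set.projIcc (0 : ℝ) 1 zero_le_one t)).real {ω : BondConfig (Site 3) | ∃ x y :
      Site 3, e = s(x, y) ∧ (∃ v ∈ box 3 n, ω \ {e} ∈ openConnIn (↑(box 3 (2 * n)) : Set (Site 3))
      x v) ∧ (∀ w ∈ innerBoundary (zdGraph 3) (box 3 (2 * n)), ω \ {e} ∉ openConnIn (↑(box 3 (2 *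
      n)) : Set (Site 3)) x w) ∧ (∃ w ∈ innerBoundary (zdGraph 3) (box 3 (2 * n)), ω \ {e} ∈
      openConnIn (↑(box 3 (2 * n)) : Set (Site 3)) y w) ∧ (∀ v ∈ box 3 n, ω \ {e} ∉ openConnIn
      (↑(box 3 (2 * n)) : Set (Site 3)) y v)} ≤ C) ↔
    (∃ C : ℝ, ∃ᶠ n : ℕ in atTop, ∫ t in (0 : ℝ)..(criticalProbI 3 : ℝ), ∑ e ∈ edgesIn (zdGraph 3)
      (box 3 (2 * n)), (bondPercolation (zdGraph 3) (Set.projIcc (0 : ℝ) 1 zero_le_one t)).real {ω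
      : BondConfig (Site 3) | ∃ x y : Site 3, e = s(x, y) ∧ (∃ v ∈ box 3 n, ω \ {e} ∈ openConnIn
      (↑(box 3 (2 * n)) : Set (Site 3)) x v) ∧ (∀ w ∈ innerBoundary (zdGraph 3) (box 3 (2 * n)), ω
      \ {e} ∉ openConnIn (↑(box 3 (2 * n)) : Set (Site 3)) x w) ∧ (∃ w ∈ innerBoundary (zdGraph 3)
      (box 3 (2 * n)), ω \ {e} ∈ openConnIn (↑(box 3 (2 * n)) : Set (Site 3)) y w) ∧ (∀ v ∈ box 3
      n, ω \ {e} ∉ openConnIn (↑(box 3 (2 * n)) : Set (Site 3)) y v)} ≤ C) :=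
  ⟨BirthBudget.birthBudget_of_window, BirthBudget.window_of_birthBudget⟩

/-- **`SubpolynomialBlocking ⟹ E_{p_c}[N_n] = o(log n)`**: if the critical annulus is blocked with
probability at least `n^{-s}` eventually (the route's rank-4 crux, stmt-CriticalPhenomena-4446), then
`E_{p_c}[N_n] = Σ_{k<#B(n)} P_{p_c}(repEvent 3 k n) ≤ s · log n` eventually — for every `s > 0`. -/
theorem sum_real_repEvent_le_mul_log_of_subpolynomialBlocking
    (h : Summit.CriticalPhenomena.PercolationContinuityZ3.Theses.PercNonProliferation.SubpolynomialBlocking)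
    (s : ℝ) (hs : 0 < s) :
    ∀ᶠ n : ℕ in atTop, ∑ k ∈ Finset.range (box 3 n).card,
      (bondPercolation (zdGraph 3) (criticalProbI 3)).real (repEvent 3 k n) ≤ s * Real.log n := by
  filter_upwards [h s hs, eventually_ge_atTop 1] with n hn hn1
  set μ := bondPercolation (zdGraph 3) (criticalProbI 3) with hμ
  have hmeas : MeasurableSet (annulusCrossing 3 n) :=
    (repEvent_zero_eq_annulusCrossing 3 n) ▸ measurableSet_repEvent 3 0 n
  have hblk : μ.real {ω | ¬ ∃ x ∈ box 3 n, ∃ y ∈ innerBoundary (zdGraph 3) (box 3 (2 * n)),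
      ω ∈ openConnIn (↑(box 3 (2 * n)) : Set (Site 3)) x y} = 1 - μ.real (annulusCrossing 3 n) := by
    rw [← probReal_compl_eq_one_sub hmeas]
    rfl
  have hnpos : (0 : ℝ) < (n : ℝ) ^ (-s) := Real.rpow_pos_of_pos (by exact_mod_cast hn1) _
  have hlow : (n : ℝ) ^ (-s) ≤ 1 - μ.real (annulusCrossing 3 n) := hblk ▸ hn
  have hu : μ.real (annulusCrossing 3 n) < 1 := by linarith
  -- `E_{p_c}[N_n] ≤ -log(1 - u_n(p_c))`: the log-ledger at `b = p_c` with the merge integral dropped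
  have hE : ∑ k ∈ Finset.range (box 3 n).card, μ.real (repEvent 3 k n) ≤
      - Real.log (1 - μ.real (annulusCrossing 3 n)) := by
    have hproj : Set.projIcc (0 : ℝ) 1 zero_le_one ((criticalProbI 3 : unitInterval) : ℝ) = criticalProbI 3 :=
      Set.projIcc_val zero_le_one (criticalProbI 3)
    have hS := stub_logLedger (stub_ledger stub_signedRusso stub_typeTable) stub_screening stub_anchor 3 n
      (criticalProbI 3 : ℝ) hn1 (criticalProbI 3).2.1 (criticalProbI 3).2.2 (by rw [hproj]; exact hu)
    rw [hproj] at hS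
    have hm : 0 ≤ ∫ t in (0 : ℝ)..((criticalProbI 3 : unitInterval) : ℝ),
        ∑ e ∈ edgesIn (zdGraph 3) (box 3 (2 * n)), (bondPercolation (zdGraph 3) (Set.projIcc (0 :
        ℝ) 1 zero_le_one t)).real {ω : BondConfig (Site 3) | ∃ x y : Site 3, e = s(x, y) ∧ ω \ {e}
        ∉ openConnIn (↑(box 3 (2 * n)) : Set (Site 3)) x y ∧ (∃ v ∈ box 3 n, ω \ {e} ∈ openConnIn
        (↑(box 3 (2 * n)) : Set (Site 3)) x v) ∧ (∃ w ∈ innerBoundary (zdGraph 3) (box 3 (2 * n)),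
        ω \ {e} ∈ openConnIn (↑(box 3 (2 * n)) : Set (Site 3)) x w) ∧ (∃ v ∈ box 3 n, ω \ {e} ∈
        openConnIn (↑(box 3 (2 * n)) : Set (Site 3)) y v) ∧ (∃ w ∈ innerBoundary (zdGraph 3) (box 3
        (2 * n)), ω \ {e} ∈ openConnIn (↑(box 3 (2 * n)) : Set (Site 3)) y w)} :=
      intervalIntegral.integral_nonneg (criticalProbI 3).2.1 fun _ _ =>
        Finset.sum_nonneg fun _ _ => measureReal_nonneg
    rw [hμ]
    linarith
  have hlog : - Real.log (1 - μ.real (annulusCrossing 3 n)) ≤ s * Real.log n := by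
    have h1 : Real.log ((n : ℝ) ^ (-s)) ≤ Real.log (1 - μ.real (annulusCrossing 3 n)) :=
      Real.log_le_log hnpos hlow
    rw [Real.log_rpow (by exact_mod_cast hn1)] at h1
    linarith
  exact hE.trans hlog

end Summit.CriticalPhenomena.PercolationContinuityZ3.Theorems.NonProliferation

end
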